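import Mathlib.Analysis.Calculus.MeanValue
import Mathlib.Analysis.Calculus.Deriv.Shift
import Mathlib.MeasureTheory.Integral.IntervalIntegral.FundThmCalculus
import Mathlib.Algebra.Ring.Periodic
import Mathlib.LinearAlgebra.Basis.Defs
import HarnessLib

/-!
# Oscillation of a periodic function through a chain of derivatives
(the real-variable step of Moeglin–Waldspurger, *Spectral decomposition and Eisenstein series*
(1995), Lemma I.2.10, "via integration by parts")

Topic `NumberTheory/Automorphic`; an elementary brick of the discharge of the named fact
`AutomorphicRepsGL.rapidlyDecreasingOnSiegelSets_of_cuspidal` (MW Cor. I.2.12 for `GL_n`: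
cuspidal functions of uniformly moderate growth are rapidly decreasing on Siegel sets). In the
proof of MW Lemma I.2.10 a smooth function on the torus `(ℤ\ℝ)^d` is compared with its mean value,
the gain `m_{P₀}(g)^{-hα}` coming from `h` derivatives (MW: Fourier inversion on `(ℤ\ℝ)^d` and
`h`-fold integration by parts, `(2πiξ_ℓ)^{-h}`). This file proves the derivative bound in the
elementary mean-value form that avoids Fourier series altogether:

* `periodic_norm_sub_le_of_hasDerivAt` — a `1`-periodic function with derivative bounded
  by `M` has oscillation `≤ M` (mean value inequality over one period);
* `norm_le_of_hasDerivAt_periodic` — a continuous function with a `1`-periodic primitive (hence of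
  mean zero over a period) is bounded by its own oscillation;
* `periodic_norm_sub_le_of_derivChain` — **if `f₀` is `1`-periodic and
  `f₀, f₁, …, f_h` (`h ≥ 1`) is a chain of derivatives (`f_{j+1} = f_j'`) with `‖f_h‖ ≤ M`, then
  `‖f₀ x - f₀ y‖ ≤ M` for all `x, y`**;
* `norm_sub_le_sum_of_derivChains` — the several-variables consequence on a real vector space `E`:
  if `F : E → ℂ` is periodic under the vectors `b i` and along each `b i` admits a chain of `h ≥ 1`
  directional derivatives ending with a function bounded by `M i`, then
  `‖F (v + ∑ cᵢ • bᵢ) - F v‖ ≤ ∑ Mᵢ` (telescoping, one direction at a time), and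
  `norm_sub_le_sum_of_derivChains_of_basis` — the same for any two points when `b` is a basis.

Everything here is proved; [folklore] real analysis (the role in MW I.2.10 is the only reason for
the location of the file).

## References

* C. Moeglin, J.-L. Waldspurger, *Spectral decomposition and Eisenstein series*, Cambridge Tracts
  in Math. 113 (1995), proof of Lemma I.2.10 [MoeglinWaldspurger1995].
-/

noncomputable section

open Set MeasureTheory intervalIntegral

namespace Literature.NumberTheory.Automorphic

/-! ### One variable -/

section OneVariable

variable {f f' : ℝ → ℂ}

/-- **Mean value inequality over one period**: a `1`-periodic function whose derivative is
bounded by `M` has oscillation at most `M` (replace `y` by its translate in `[x, x + 1)` and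
apply the mean value inequality on an interval of length `≤ 1`). [folklore] -/
theorem periodic_norm_sub_le_of_hasDerivAt (hper : Function.Periodic f 1)
    (hderiv : ∀ x, HasDerivAt f (f' x) x) {M : ℝ} (hM : ∀ x, ‖f' x‖ ≤ M) (x y : ℝ) :
    ‖f x - f y‖ ≤ M := by
  -- the translate of `y` in `[x, x + 1)`
  set y' : ℝ := y - (⌊y - x⌋ : ℤ) * 1 with hy'
  have hfy : f y' = f y := hper.sub_int_mul_eq ⌊y - x⌋
  have hy'1 : y' - x = Int.fract (y - x) := by
    rw [hy', Int.fract, mul_one]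
    ring
  have hdist : ‖y' - x‖ ≤ 1 := by
    rw [hy'1, Real.norm_eq_abs, abs_of_nonneg (Int.fract_nonneg _)]
    exact (Int.fract_lt_one _).le
  have hM0 : 0 ≤ M := (norm_nonneg _).trans (hM 0)
  have key : ‖f y' - f x‖ ≤ M * ‖y' - x‖ :=
    convex_univ.norm_image_sub_le_of_norm_hasDerivWithin_le
      (fun z _ => (hderiv z).hasDerivWithinAt) (fun z _ => hM z) (mem_univ x) (mem_univ y')
  calc ‖f x - f y‖ = ‖f y' - f x‖ := by rw [hfy, norm_sub_rev]
    _ ≤ M * ‖y' - x‖ := key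
    _ ≤ M * 1 := mul_le_mul_of_nonneg_left hdist hM0
    _ = M := mul_one M

/-- **A continuous derivative of a periodic function is bounded by its oscillation**: if `F` is
`1`-periodic with `F' = f` continuous, then `∫₀¹ f = F 1 - F 0 = 0`, so
`f x = ∫₀¹ (f x - f t) dt` and `‖f x‖ ≤ sup_{t} ‖f x - f t‖`. [folklore] -/
theorem norm_le_of_hasDerivAt_periodic {F : ℝ → ℂ} (hper : Function.Periodic F 1)
    (hderiv : ∀ x, HasDerivAt F (f x) x) (hcont : Continuous f) {M : ℝ}
    (hosc : ∀ x y, ‖f x - f y‖ ≤ M) (x : ℝ) : ‖f x‖ ≤ M := by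
  have hint : ∫ t in (0 : ℝ)..1, f t = 0 := by
    rw [integral_eq_sub_of_hasDerivAt (fun t _ => hderiv t) (hcont.intervalIntegrable 0 1)]
    have h1 : F 1 = F 0 := by simpa using hper 0
    rw [h1, sub_self]
  have hconst : ∫ _ in (0 : ℝ)..1, f x = f x := by
    rw [intervalIntegral.integral_const, sub_zero, one_smul]
  have hrepr : f x = ∫ t in (0 : ℝ)..1, (f x - f t) := by
    rw [intervalIntegral.integral_sub intervalIntegrable_const (hcont.intervalIntegrable 0 1),
      hint, sub_zero, hconst]
  rw [hrepr]
  have h := intervalIntegral.norm_integral_le_of_norm_le_const (a := (0 : ℝ)) (b := 1)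
    (f := fun t => f x - f t) (C := M) fun t _ => hosc x t
  simpa using h

/-- The derivatives in a chain starting from a `1`-periodic function are `1`-periodic (uniqueness
of derivatives: `f_j (· + 1) = f_j` gives `f_{j+1} (x + 1) = f_{j+1} x`). [folklore] -/
theorem periodic_derivChain {f : ℕ → ℝ → ℂ} {h : ℕ} (hper : Function.Periodic (f 0) 1)
    (hderiv : ∀ j < h, ∀ x, HasDerivAt (f j) (f (j + 1) x) x) :
    ∀ j ≤ h, Function.Periodic (f j) 1 := by
  intro j
  induction j with
  | zero => exact fun _ => hper
  | succ j ih =>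
    intro hj x
    have hjh : j < h := Nat.lt_of_succ_le hj
    have hpj : Function.Periodic (f j) 1 := ih hjh.le
    -- `f j (· + 1) = f j`, so both `f (j+1) (x+1)` and `f (j+1) x` are derivatives of `f j` at `x`
    have h1 : HasDerivAt (fun y => f j (y + 1)) (f (j + 1) (x + 1)) x :=
      (hderiv j hjh (x + 1)).comp_add_const x 1
    have hfun : (fun y => f j (y + 1)) = f j := funext fun y => hpj y
    rw [hfun] at h1
    exact h1.unique (hderiv j hjh x)

/-- **Oscillation through a chain of derivatives**: let `f₀` be `1`-periodic and let
`f₀, f₁, …, f_h` (`h ≥ 1`) satisfy `f_j' = f_{j+1}` everywhere for `j < h`, with `‖f_h x‖ ≤ M` for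
all `x`. Then `‖f₀ x - f₀ y‖ ≤ M` for all `x, y`. Induction on `h`: the oscillation of `f₁` is
`≤ M` by induction, hence `‖f₁‖ ≤ M` (`norm_le_of_hasDerivAt_periodic`, `f₁` having the periodic
primitive `f₀` and mean zero), hence the oscillation of `f₀` is `≤ M` (mean value inequality).
This is the elementary substitute for the `h`-fold integration by parts of MW I.2.10. [folklore] -/
theorem periodic_norm_sub_le_of_derivChain {h : ℕ} (hh : 1 ≤ h) {f : ℕ → ℝ → ℂ}
    (hper : Function.Periodic (f 0) 1) (hderiv : ∀ j < h, ∀ x, HasDerivAt (f j) (f (j + 1) x) x)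
    {M : ℝ} (hM : ∀ x, ‖f h x‖ ≤ M) : ∀ x y : ℝ, ‖f 0 x - f 0 y‖ ≤ M := by
  induction h generalizing f with
  | zero => exact absurd hh (by decide)
  | succ h ih =>
    intro x y
    rcases Nat.eq_zero_or_pos h with rfl | hpos
    · -- `h + 1 = 1`: mean value inequality with `f₁` bounded by `M`
      exact periodic_norm_sub_le_of_hasDerivAt hper (hderiv 0 Nat.one_pos) hM x y
    · -- the shifted chain `g_j = f_{j+1}` has length `h ≥ 1` and starts at the periodic `f₁`
      have hper1 : Function.Periodic (f 1) 1 :=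
        periodic_derivChain hper hderiv 1 (Nat.succ_le_succ (Nat.zero_le h))
      have hosc1 : ∀ x y, ‖f 1 x - f 1 y‖ ≤ M := by
        refine ih hpos (f := fun j => f (j + 1)) hper1 (fun j hj z => ?_) (fun z => hM z)
        exact hderiv (j + 1) (Nat.succ_lt_succ hj) z
      -- `f₁` is continuous (it has the derivative `f₂`, as `1 < h + 1`)
      have hcont1 : Continuous (f 1) := by
        have hd : ∀ z, HasDerivAt (f 1) (f 2 z) z := hderiv 1 (Nat.succ_lt_succ hpos)
        exact continuous_iff_continuousAt.2 fun z => (hd z).continuousAt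
      have hbound1 : ∀ z, ‖f 1 z‖ ≤ M :=
        norm_le_of_hasDerivAt_periodic hper (hderiv 0 (Nat.succ_pos h)) hcont1 hosc1
      exact periodic_norm_sub_le_of_hasDerivAt hper (hderiv 0 (Nat.succ_pos h)) hbound1 x y

end OneVariable

/-! ### Several variables: telescoping along the period vectors -/

section SeveralVariables

variable {E : Type*} [AddCommGroup E] [Module ℝ E] {ι : Type*}

/-- **Telescoping estimate on a torus.** Let `F : E → ℂ` be periodic under the vectors `b i`
(`F (v + b i) = F v`), and suppose that along each `b i` there is a chain of directional
derivatives `D i 0 = F, D i 1, …, D i h` (`h ≥ 1`):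
`d/ds (D i j (v + s • b i)) = D i (j+1) (v + s • b i)` for `j < h`, with `‖D i h v‖ ≤ M i`
everywhere. Then for every finite set `s` of indices and all coefficients `c`,
`‖F (v + ∑_{i ∈ s} c i • b i) - F v‖ ≤ ∑_{i ∈ s} M i`: move one direction at a time and apply
`periodic_norm_sub_le_of_derivChain` to `s ↦ F (w + s • b i)`. [folklore] -/
theorem norm_sub_le_sum_of_derivChains {F : E → ℂ} {b : ι → E} {h : ℕ} (hh : 1 ≤ h)
    {D : ι → ℕ → E → ℂ} (hD0 : ∀ i, D i 0 = F) (hper : ∀ i v, F (v + b i) = F v)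
    (hderiv : ∀ i, ∀ j < h, ∀ (v : E) (s : ℝ),
      HasDerivAt (fun s : ℝ => D i j (v + s • b i)) (D i (j + 1) (v + s • b i)) s)
    {M : ι → ℝ} (hM : ∀ i v, ‖D i h v‖ ≤ M i) (s : Finset ι) (c : ι → ℝ) (v : E) :
    ‖F (v + ∑ i ∈ s, c i • b i) - F v‖ ≤ ∑ i ∈ s, M i := by
  classical
  induction s using Finset.induction_on generalizing v with
  | empty => simp
  | insert a s ha ih =>
    rw [Finset.sum_insert ha, Finset.sum_insert ha]
    set w : E := v + ∑ i ∈ s, c i • b i with hw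
    have hsplit : v + (c a • b a + ∑ i ∈ s, c i • b i) = w + c a • b a := by
      rw [hw]; abel
    rw [hsplit]
    -- one direction: the chain `j ↦ (s ↦ D a j (w + s • b a))`
    have hone : ‖F (w + c a • b a) - F w‖ ≤ M a := by
      have hper1 : Function.Periodic (fun s : ℝ => D a 0 (w + s • b a)) 1 := by
        intro s
        simp only [hD0, add_smul, one_smul, ← add_assoc]
        exact hper a _
      have key := periodic_norm_sub_le_of_derivChain hh (f := fun j s => D a j (w + s • b a)) hper1
        (fun j hj x => hderiv a j hj w x) (fun x => hM a _) (c a) 0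
      simpa only [hD0, zero_smul, add_zero] using key
    calc ‖F (w + c a • b a) - F v‖
          = ‖(F (w + c a • b a) - F w) + (F w - F v)‖ := by rw [sub_add_sub_cancel]
      _ ≤ ‖F (w + c a • b a) - F w‖ + ‖F w - F v‖ := norm_add_le _ _
      _ ≤ M a + ∑ i ∈ s, M i := add_le_add hone (ih v)

/-- **Oscillation on a torus with a basis of periods**: under the hypotheses of
`norm_sub_le_sum_of_derivChains` for a (finite) basis `b` of `E` consisting of periods of `F`,
`‖F v - F v'‖ ≤ ∑ᵢ Mᵢ` for ALL `v, v'` (write `v - v' = ∑ cᵢ • bᵢ`). [folklore] -/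
theorem norm_sub_le_sum_of_derivChains_of_basis [Fintype ι] {F : E → ℂ} (b : Module.Basis ι ℝ E)
    {h : ℕ} (hh : 1 ≤ h) {D : ι → ℕ → E → ℂ} (hD0 : ∀ i, D i 0 = F)
    (hper : ∀ i v, F (v + b i) = F v)
    (hderiv : ∀ i, ∀ j < h, ∀ (v : E) (s : ℝ),
      HasDerivAt (fun s : ℝ => D i j (v + s • b i)) (D i (j + 1) (v + s • b i)) s)
    {M : ι → ℝ} (hM : ∀ i v, ‖D i h v‖ ≤ M i) (v v' : E) :
    ‖F v - F v'‖ ≤ ∑ i, M i := by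
  have hrepr : v = v' + ∑ i, b.repr (v - v') i • b i := by
    rw [b.sum_repr (v - v'), add_sub_cancel]
  rw [hrepr]
  exact norm_sub_le_sum_of_derivChains hh hD0 hper hderiv hM Finset.univ _ v'

end SeveralVariables

end Literature.NumberTheory.Automorphic
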